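import Summits.CriticalPhenomena.PercolationContinuityZ3.Theorems.PercNearOneGluingNoHeavyRsw3AnnulusTwoArmFarCritical
import HarnessLib

/-!
# RSW3 lane (P2, gen 14): a positive DENSITY of good scales with positive probability — first-moment transfer of the every-scale bounds
# (far two-arm, annulus two-arm) to "at least `cK` of the scales `1, …, K` are good, with probability `≥ c`"

builds on p205010 (kernel theorem, internal audit signed; external expert review pending)

Cell `prim-rsw3`, prover seat `prim-rsw3-p2` (gen 14), memo `run/shared/lean/prim/rsw3/P2-RSWLITE.md` §21.
Support file (`--supports stmt-CriticalPhenomena-4575`); no definitions, no named facts, no sorries.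

The lane's every-scale lower bounds (`α₂(N,3N) ≥ c`, `P(far(N,3N,jN)) ≥ c_j`, two spanning clusters, …) give "infinitely many good scales almost surely"
only for events read on DISJOINT annuli (gen 12 `ae_frequently_annulusTwoCluster_criticalProbI`, independence).  The far two-arm event of scale `N` is read
on the whole ball `Λ(jN)`, so no independence is available; what survives is the first-moment statement, valid for ANY family of events:

* `sub_le_card_mul_measureReal_setOf_le_sum_indicator` (abstract, any probability space): if `A_1, …, A_K` are events and `0 ≤ t`, then
  `Σ_i P(A_i) - t ≤ K · P(t ≤ #{i : A_i occurs})` (the count written as `Σ_i 1_{A_i}`);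
* `le_measureReal_setOf_le_sum_indicator_of_forall_le`: if `P(A_i) ≥ c` for all `i ≤ K` then `P(#{i ≤ K : A_i} ≥ cK/2) ≥ c/2`;
* `exists_le_real_density_far_criticalProbI`: for every `j ≥ 3` there is `c > 0` with `P_{p_c}(#{1 ≤ N ≤ K : far(N, 3N, jN)} ≥ cK) ≥ c` for every `K ≥ 1` —
  at `p_c(ℤ³)`, with probability bounded below, a positive FRACTION of ALL the scales `N ≤ K` carry two clusters crossing `Λ(3N) ∖ Λ(N)` that are not joined
  inside `Λ(jN)`;
* `exists_le_real_density_compl_uniqZone_criticalProbI`: the same for gen 13's aspect-`3` two-arm events `(uniqZone N (3N))ᶜ`.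

References: G. Grimmett, *Percolation* (1999), §2.2 [GrimmettPercolation1999]; M. Aizenman, Nucl. Phys. B 485 (1997), §2 [Aizenman1997]. [folklore]
-/

noncomputable section

namespace Summit.CriticalPhenomena.PercolationContinuityZ3.Theorems.Rsw3

open MeasureTheory Literature.Probability.LatticeModels Literature.Probability.Percolation
open Literature.Probability.Percolation.KestenZhang Literature.Probability.Percolation.KozmaNitzan SimpleGraph Relation
open Summit.CriticalPhenomena.PercolationContinuityZ3.Theorems.Crossing SurfaceTension

/-! ## First moment: many events of probability `≥ c` ⇒ a positive fraction occur with probability `≥ c/2` -/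

/-- **First-moment transfer** (any probability space): for events `A i`, `i ∈ s`, and `0 ≤ t`,
`Σ_{i ∈ s} P(A i) - t ≤ #s · P(t ≤ Σ_{i ∈ s} 1_{A i})` — integrate the pointwise bound `Σ_i 1_{A i} ≤ t + #s · 1_{t ≤ Σ_i 1_{A i}}`. [folklore] -/
theorem sub_le_card_mul_measureReal_setOf_le_sum_indicator {Ω : Type*} [MeasurableSpace Ω] (μ : Measure Ω) [IsProbabilityMeasure μ]
    {ι : Type*} (s : Finset ι) (A : ι → Set Ω) (hA : ∀ i ∈ s, MeasurableSet (A i)) {t : ℝ} (ht : 0 ≤ t) :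
    (∑ i ∈ s, μ.real (A i)) - t ≤
      s.card * μ.real {ω | t ≤ ∑ i ∈ s, (A i).indicator (fun _ => (1 : ℝ)) ω} := by
  classical
  set f : Ω → ℝ := fun ω => ∑ i ∈ s, (A i).indicator (fun _ => (1 : ℝ)) ω with hf
  have hf_meas : Measurable f :=
    Finset.measurable_sum s fun i hi => measurable_const.indicator (hA i hi)
  have hint_i : ∀ i ∈ s, Integrable (fun ω => (A i).indicator (fun _ => (1 : ℝ)) ω) μ :=
    fun i hi => (integrable_const (1 : ℝ)).indicator (hA i hi)
  have hf_int : Integrable f μ := integrable_finsetSum s hint_i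
  set S : Set Ω := {ω | t ≤ f ω} with hS
  have hSm : MeasurableSet S := measurableSet_le measurable_const hf_meas
  -- `∫ f = Σ P(A i)`
  have hint_f : ∫ ω, f ω ∂μ = ∑ i ∈ s, μ.real (A i) := by
    rw [integral_finsetSum s hint_i]
    refine Finset.sum_congr rfl fun i hi => ?_
    exact integral_indicator_one (hA i hi)
  -- pointwise bound
  have hle : ∀ ω, f ω ≤ t + (s.card : ℝ) * S.indicator (fun _ => (1 : ℝ)) ω := by
    intro ω
    by_cases hω : ω ∈ S
    · rw [Set.indicator_of_mem hω, mul_one]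
      have hfc : f ω ≤ s.card := by
        have : f ω ≤ ∑ _i ∈ s, (1 : ℝ) :=
          Finset.sum_le_sum fun i _ => Set.indicator_le_self' (fun _ _ => zero_le_one) ω |>.trans (le_of_eq rfl)
        simpa using this
      linarith
    · rw [Set.indicator_of_notMem hω, mul_zero, add_zero]
      have : ¬ t ≤ f ω := hω
      linarith
  have hg_int : Integrable (fun ω => t + (s.card : ℝ) * S.indicator (fun _ => (1 : ℝ)) ω) μ :=
    (integrable_const t).add (((integrable_const (1 : ℝ)).indicator hSm).const_mul _)
  have hmono := integral_mono hf_int hg_int hle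
  have h3 : ∫ a, S.indicator (fun _ => (1 : ℝ)) a ∂μ = μ.real S := integral_indicator_one hSm
  rw [hint_f, integral_add (integrable_const t) (((integrable_const (1 : ℝ)).indicator hSm).const_mul _), integral_const,
    integral_const_mul, h3] at hmono
  simp only [probReal_univ, smul_eq_mul, one_mul] at hmono
  linarith

/-- **Positive fraction with positive probability**: if `P(A i) ≥ c` for every `i ∈ s` (`s` nonempty) then
`P(c·#s/2 ≤ Σ_{i ∈ s} 1_{A i}) ≥ c/2`. [folklore] -/
theorem le_measureReal_setOf_le_sum_indicator_of_forall_le {Ω : Type*} [MeasurableSpace Ω] (μ : Measure Ω) [IsProbabilityMeasure μ]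
    {ι : Type*} (s : Finset ι) (hs : s.Nonempty) (A : ι → Set Ω) (hA : ∀ i ∈ s, MeasurableSet (A i)) {c : ℝ} (hc : 0 ≤ c)
    (h : ∀ i ∈ s, c ≤ μ.real (A i)) :
    c / 2 ≤ μ.real {ω | c * s.card / 2 ≤ ∑ i ∈ s, (A i).indicator (fun _ => (1 : ℝ)) ω} := by
  have hcard : (0 : ℝ) < s.card := by exact_mod_cast Finset.card_pos.2 hs
  have ht : (0 : ℝ) ≤ c * s.card / 2 := by positivity
  have hmain := sub_le_card_mul_measureReal_setOf_le_sum_indicator μ s A hA ht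
  have hsum : c * s.card ≤ ∑ i ∈ s, μ.real (A i) := by
    have := Finset.card_nsmul_le_sum s (fun i => μ.real (A i)) c h
    simpa [nsmul_eq_mul, mul_comm] using this
  -- `c·#s/2 ≤ #s · P(S)` ⇒ `c/2 ≤ P(S)`
  have h2 : c * s.card / 2 ≤ (s.card : ℝ) * μ.real {ω | c * s.card / 2 ≤ ∑ i ∈ s, (A i).indicator (fun _ => (1 : ℝ)) ω} := by
    linarith
  by_contra hlt
  push Not at hlt
  have : (s.card : ℝ) * μ.real {ω | c * s.card / 2 ≤ ∑ i ∈ s, (A i).indicator (fun _ => (1 : ℝ)) ω} < (s.card : ℝ) * (c / 2) :=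
    mul_lt_mul_of_pos_left hlt hcard
  linarith

/-! ## A positive density of far scales, and of two-arm scales, with positive probability -/

/-- **Positive density of far scales at `p_c(ℤ³)`.**  For every `j ≥ 3` there is `c > 0` such that for every `K ≥ 1`,
`c ≤ P_{p_c}(c·K ≤ #{N ∈ {1,…,K} : far(N, 3N, jN)})` (the count written as a sum of indicators): with probability bounded below, a positive fraction of
ALL the scales up to `K` carry two clusters crossing `Λ(3N) ∖ Λ(N)` that are not joined inside `Λ(jN)`.  First moment over `exists_le_real_far_criticalProbI`; no
independence is used or available (the events are read on the nested balls `Λ(jN)`).  builds on p205010 (kernel theorem, internal audit signed; external expert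
review pending). [cite: Aizenman1997, §2 Thm. 2] -/
theorem exists_le_real_density_far_criticalProbI (j : ℕ) (hj : 3 ≤ j) :
    ∃ c : ℝ, 0 < c ∧ ∀ K : ℕ, 1 ≤ K →
      c ≤ (bondPercolation (zdGraph 3) (criticalProbI 3)).real
        {ω | c * K ≤ ∑ N ∈ Finset.Icc 1 K,
          {ω' : BondConfig (Site 3) | ∃ x ∈ box 3 N, ∃ y ∈ box 3 N, ω' ∈ toBdry (3 * N) x ∧ ω' ∈ toBdry (3 * N) y ∧
            ω' ∉ openConnIn (↑(box 3 (j * N)) : Set (Site 3)) x y}.indicator (fun _ => (1 : ℝ)) ω} := by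
  obtain ⟨c, hc, h⟩ := exists_le_real_far_criticalProbI j hj
  refine ⟨c / 2, by positivity, fun K hK => ?_⟩
  have hs : (Finset.Icc 1 K).Nonempty := ⟨1, Finset.mem_Icc.2 ⟨le_rfl, hK⟩⟩
  have hcardK : ((Finset.Icc 1 K).card : ℝ) = K := by simp
  have hmain := le_measureReal_setOf_le_sum_indicator_of_forall_le (bondPercolation (zdGraph 3) (criticalProbI 3)) (Finset.Icc 1 K) hs
    (fun N => {ω' : BondConfig (Site 3) | ∃ x ∈ box 3 N, ∃ y ∈ box 3 N, ω' ∈ toBdry (3 * N) x ∧ ω' ∈ toBdry (3 * N) y ∧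
      ω' ∉ openConnIn (↑(box 3 (j * N)) : Set (Site 3)) x y})
    (fun N _ => measurableSet_far N (3 * N) (j * N)) hc.le (fun N hN => h N (Finset.mem_Icc.1 hN).1)
  rw [hcardK] at hmain
  have e : c * (K : ℝ) / 2 = c / 2 * K := by ring
  rw [e] at hmain
  exact hmain

/-- **Positive density of aspect-`3` two-arm scales at `p_c(ℤ³)`** (first moment over gen 13's `exists_le_annulusTwoArmProb_criticalProbI_three`): there is `c > 0`
with `c ≤ P_{p_c}(c·K ≤ #{N ∈ {1,…,K} : (uniqZone N (3N))ᶜ})` for every `K ≥ 1`.  builds on p205010 (kernel theorem, internal audit signed; external expert review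
pending). [cite: Aizenman1997, §2 Thm. 2] -/
theorem exists_le_real_density_compl_uniqZone_criticalProbI :
    ∃ c : ℝ, 0 < c ∧ ∀ K : ℕ, 1 ≤ K →
      c ≤ (bondPercolation (zdGraph 3) (criticalProbI 3)).real
        {ω | c * K ≤ ∑ N ∈ Finset.Icc 1 K, ((uniqZone (d := 3) N (3 * N))ᶜ).indicator (fun _ => (1 : ℝ)) ω} := by
  obtain ⟨c, hc, h⟩ := exists_le_annulusTwoArmProb_criticalProbI_three
  refine ⟨c / 2, by positivity, fun K hK => ?_⟩
  have hs : (Finset.Icc 1 K).Nonempty := ⟨1, Finset.mem_Icc.2 ⟨le_rfl, hK⟩⟩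
  have hcardK : ((Finset.Icc 1 K).card : ℝ) = K := by simp
  have hmain := le_measureReal_setOf_le_sum_indicator_of_forall_le (bondPercolation (zdGraph 3) (criticalProbI 3)) (Finset.Icc 1 K) hs
    (fun N => (uniqZone (d := 3) N (3 * N))ᶜ) (fun N _ => (measurableSet_uniqZone' N (3 * N)).compl) hc.le
    (fun N hN => by have := h N (Finset.mem_Icc.1 hN).1; simpa only [annulusTwoArmProb] using this)
  rw [hcardK] at hmain
  have e : c * (K : ℝ) / 2 = c / 2 * K := by ring
  rw [e] at hmain
  exact hmain

end Summit.CriticalPhenomena.PercolationContinuityZ3.Theorems.Rsw3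

end
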